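import Literature.AlgebraicGeometry.Resolution.WeightedCentreBendingLadder
import HarnessLib

/-!
# The bending ladder for the whole binomial family: `max W(x^{p^e} + y^p + y^{p+r}) = (p, K_e(r))`, `K_0 = 1`, `K_{e+1} = p K_e + r`

[ATW24] Abramovich–Temkin–Włodarczyk, *Functorial embedded resolution via weighted blowings up*,
Algebra & Number Theory 18 (2024), §5.1 (p. 1575), Thm. 5.3.1 (2)–(3) (p. 1578), Lemma 5.2.6 (p. 1576),
Rem. 5.2.3 / Def. 2.4.1 (2) (pp. 1568, 1576: the monomial valuation and domination).
[CJS20] Cossart–Jannsen–Saito, *Desingularization: Invariants and Strategy*, LNM 2270 (2020), Def. 8.1 (3) /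
Def. 8.2 (1) (pp. 117–118: `δ(f; u; y)`), Def. 8.8 / Thm. 8.16 (pp. 119–121: vertex preparation `y ↦ y + λ u^A`,
dissolving the solvable vertices one at a time).
[Hau10] Hauser, Bull. AMS 47 (2010), §C (p. 9: failure of maximal contact for `x^p + y^p z`) and §D (p. 12: kangaroo points).
[HP19b] Hauser–Perlega, Publ. RIMS 60 (2024), §7 (p. 798: the residual order of `z^{p^e} + F`, bounded jumps).

## What is proved (the polynomial `W(f)` model of `WeightedCentreInvariantSet`; `char k = p`; `x = X 0`, `y = X 1`)

`WeightedCentreBendingLadder` treats `x^{p^e} + y^p + y^{p+1}`.  Here the second exponent is any `p + r` with `p ∤ r`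
(the family of `WeightedCentreInseparableSplit`, whose first rung `max W(x^p + y^p + y^{p+r}) = (p, p + r)` is
`isMaxInv_family` there), with signed integer coefficients carried through the ladder:

* `IsBentR p r K a v ℓ G` — `G = y^p + v x^K + ℓ x^a y + R`, `v, ℓ ∈ ℤ`, every monomial `x^i y^j` of `R` with
  `p i + K j ≥ p K + 2 r` (one inequality for the monomial valuation `ν_{(p,K)}`).
* **`IsBentR.isMaxInv` — `max W(G) = (p, K)`** whenever `2 ≤ p < K`, `1 ≤ r`, `p a + K = p K + r`, `p ∤ K` and `v ≠ 0`
  in `k` (any field): `(p, K) ∈ W(G)` by the weights `1/K, 1/p`, and the two-variable vertex bound of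
  `WeightedCentreBendingCube` (`ord G = p`, `in_p G = y^p`, `δ(G; x; y) = K/p ∉ ℕ`).
* **`IsBentR.step` — the substitution `T_{K,v} : x ↦ x^p, y ↦ y − v x^K` maps `(p, r, K, a, v, ℓ)`-bent to
  `(p, r, pK + r, pa, −ℓ v, ℓ)`-bent** in characteristic `p` (`v^p = v` for `v ∈ ℤ`, so `(y − v x^K)^p + v x^{pK} = y^p`:
  the vertex dissolves; `ℓ x^{pa}(y − v x^K)` provides the new vertex `−ℓ v x^{pa + K} = −ℓ v x^{pK + r}`; the rest by
  domination, `ν_{(p, pK + r)}(T R) ≥ p ν_{(p,K)}(R) ≥ p(pK + 2r) ≥ p(pK + r) + 2r`).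
* The second-order Taylor formula `(y − x)^{s+1} = (−1)^{s+1} x^{s+1} + (s+1)(−1)^s x^s y + P`, `P ∈ (y²)` of order
  `≥ s + 1` (`exists_sub_pow_taylor₂`), which makes the FIRST rung bent without expanding binomials:
  `G_1 = x^p + (y − x)^p + (y − x)^{p+r} = y^p + (y^p − x^p)(y − x)^r` is `(p, r, p + r, p + r − 1, (−1)^{r+1}, (−1)^r r)`-bent.
* The ladder `bendKR p r` (`K_0 = 1`, `K_{e+1} = p K_e + r`, closed form `K_e = p^e + r (1 + p + ⋯ + p^{e−1})`:
  `bendKR_eq`), the vertex signs `bendV r` (`v_0 = 1`, `v_1 = (−1)^{r+1}`, `v_{e+2} = −(−1)^r r · v_{e+1}`), the shifts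
  `γ_{e+1} = T_{K_e, v_e} γ_e + v_e x^{K_e}` (`bendShiftR`), the bent forms `G_e = F_e(x, y − γ_e)` (`bendFormR`) with
  **`bendFormR_succ`: `G_{e+1} = T_{K_e, v_e} G_e`**, `isBentR_bendFormR` (induction), and
* **`isMaxInv_bending_family` — for every prime `p = char k`, every `r` with `p ∤ r` and every `e ≥ 1`,
  `max W(x^{p^e} + y^p + y^{p+r}) = (p, K_e(r))`, `K_e(r) = p^e + r (p^e − 1)/(p − 1)`** over all admissible centres after
  all polynomial coordinate changes; instances **`(2, 13)` for `x⁴ + y² + y⁵`, `(2, 19)` for `x⁴ + y² + y⁷`, `(2, 29)` for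
  `x⁸ + y² + y⁵`, `(3, 17)` for `x⁹ + y³ + y⁵`**.

For the units `u = 1 + y^r` this is the staircase formula `q + r (q − 1)/(p − 1)`, `q = p^e`: the split law (weights on
`x` and on one series in `y`) offers only `(p, q)`, and the maximum exceeds it by `r (1 + p + ⋯ + p^{e−1})`.  The case
`r = 1` is `WeightedCentreBendingLadder` (`bendKR_one_eq_bendK`).  Value type: typed theorems in the polynomial `W(f)`
model — not a resolution theorem.
-/

noncomputable section

open MvPolynomial

namespace Literature.AlgebraicGeometry.Resolution

namespace WeightedBlowup

variable {k : Type*} [Field k]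

/-! ## §1 Plumbing (two variables) -/

/-- The inverse shear on the sheared variable (plumbing). [folklore] -/
private theorem addPolyShear_symm_X_self₂₂ {σ : Type*} [DecidableEq σ] (a : σ) (q : MvPolynomial σ k) :
    (addPolyShear a q).symm (X a) = X a - killVar a q := by
  simp [addPolyShear, sub_eq_add_neg]

/-- The inverse shear fixes the other variables (plumbing). [folklore] -/
private theorem addPolyShear_symm_X_of_ne₂₂ {σ : Type*} [DecidableEq σ] (a : σ) (q : MvPolynomial σ k) {x : σ}
    (hx : x ≠ a) : (addPolyShear a q).symm (X x) = X x := by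
  simp [addPolyShear, hx]

/-- `ν_w(x^i y^j) = i·w₀ + j·w₁` (plumbing). [cite: AbramovichTemkinWlodarczyk2024, Rem. 2.4.2 (p. 1568)] -/
private theorem monomialOrd_X_pow_mul_X_pow₂₂ (w : Fin 2 → ℕ) (i j : ℕ) :
    monomialOrd w (X 0 ^ i * X 1 ^ j : MvPolynomial (Fin 2) k) = ((i * w 0 + j * w 1 : ℕ) : ℕ∞) := by
  rw [monomialOrd_mul, X_pow_eq_monomial, X_pow_eq_monomial, monomialOrd_monomial w _ one_ne_zero,
    monomialOrd_monomial w _ one_ne_zero, Finsupp.weight_single, Finsupp.weight_single, smul_eq_mul, smul_eq_mul,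
    Nat.cast_add]

/-- `ν_w(x_a^i) = i·w_a` (plumbing). [cite: AbramovichTemkinWlodarczyk2024, Rem. 2.4.2 (p. 1568)] -/
private theorem monomialOrd_X_pow₂₂ (w : Fin 2 → ℕ) (a : Fin 2) (i : ℕ) :
    monomialOrd w (X a ^ i : MvPolynomial (Fin 2) k) = ((i * w a : ℕ) : ℕ∞) := by
  rw [X_pow_eq_monomial, monomialOrd_monomial w _ one_ne_zero, Finsupp.weight_single, smul_eq_mul]

/-- `ν_w(−F) = ν_w(F)` (plumbing). [cite: AbramovichTemkinWlodarczyk2024, Rem. 5.2.3] -/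
private theorem monomialOrd_neg₂₂ {σ : Type*} (w : σ → ℕ) (F : MvPolynomial σ k) :
    monomialOrd w (-F) = monomialOrd w F := by
  rw [show -F = C (-1 : k) * F by rw [C_neg, C_1, neg_one_mul]]
  exact monomialOrd_mul_of_constantCoeff_ne_zero w (by rw [constantCoeff_C]; exact neg_ne_zero.2 one_ne_zero) F

/-- `n ≤ ν(A)`, `n ≤ ν(B)` ⟹ `n ≤ ν(A + B)` (plumbing). [cite: AbramovichTemkinWlodarczyk2024, Lemma 5.2.6] -/
private theorem le_monomialOrd_add₂₂ {σ : Type*} (w : σ → ℕ) {A B : MvPolynomial σ k} {n : ℕ∞}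
    (hA : n ≤ monomialOrd w A) (hB : n ≤ monomialOrd w B) : n ≤ monomialOrd w (A + B) :=
  le_trans (le_min hA hB) (min_monomialOrd_le_add w A B)

/-- `n ≤ ν(A)`, `n ≤ ν(B)` ⟹ `n ≤ ν(A − B)` (plumbing). [cite: AbramovichTemkinWlodarczyk2024, Lemma 5.2.6] -/
private theorem le_monomialOrd_sub₂₂ {σ : Type*} (w : σ → ℕ) {A B : MvPolynomial σ k} {n : ℕ∞}
    (hA : n ≤ monomialOrd w A) (hB : n ≤ monomialOrd w B) : n ≤ monomialOrd w (A - B) := by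
  rw [sub_eq_add_neg]
  exact le_monomialOrd_add₂₂ w hA (by rwa [monomialOrd_neg₂₂])

/-- `m ≤ ν(A)`, `n ≤ ν(B)` ⟹ `m + n ≤ ν(A·B)` (plumbing). [cite: AbramovichTemkinWlodarczyk2024, Lemma 5.2.6] -/
private theorem le_monomialOrd_mul₂₂ {σ : Type*} (w : σ → ℕ) {A B : MvPolynomial σ k} {m n : ℕ∞}
    (hA : m ≤ monomialOrd w A) (hB : n ≤ monomialOrd w B) : m + n ≤ monomialOrd w (A * B) :=
  (add_le_add hA hB).trans (add_monomialOrd_le_mul w A B)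

/-- `0 ≤ ν(A)` (plumbing). [folklore] -/
private theorem zero_le_monomialOrd₂₂ {σ : Type*} (w : σ → ℕ) (A : MvPolynomial σ k) : (0 : ℕ∞) ≤ monomialOrd w A := by
  simp

/-- `n ≤ ν(F)` ⟹ `n ≤ ν(C c · F)` for every constant `c` (plumbing). [cite: AbramovichTemkinWlodarczyk2024, Rem. 5.2.3] -/
private theorem le_monomialOrd_C_mul₂₂ {σ : Type*} (w : σ → ℕ) (c : k) {F : MvPolynomial σ k} {n : ℕ∞}
    (hF : n ≤ monomialOrd w F) : n ≤ monomialOrd w (C c * F) := by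
  by_cases hc : c = 0
  · rw [hc, C_0, zero_mul, monomialOrd_zero]; exact le_top
  · rwa [monomialOrd_mul_of_constantCoeff_ne_zero w (by rwa [constantCoeff_C]) F]

/-- Coefficients of `x^i y^j` (plumbing). [folklore] -/
private theorem coeff_X_pow_mul_X_pow₂₂ (i j : ℕ) (d : Fin 2 →₀ ℕ) :
    coeff d (X 0 ^ i * X 1 ^ j : MvPolynomial (Fin 2) k) =
      if Finsupp.single (0 : Fin 2) i + Finsupp.single 1 j = d then 1 else 0 := by
  classical
  rw [X_pow_eq_monomial, X_pow_eq_monomial, monomial_mul, mul_one, coeff_monomial]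

/-- The exponent `(i, j)` evaluated (plumbing). [folklore] -/
private theorem e_apply_zero₂₂ (i j : ℕ) : (Finsupp.single (0 : Fin 2) i + Finsupp.single 1 j : Fin 2 →₀ ℕ) 0 = i := by
  simp

/-- The exponent `(i, j)` evaluated (plumbing). [folklore] -/
private theorem e_apply_one₂₂ (i j : ℕ) : (Finsupp.single (0 : Fin 2) i + Finsupp.single 1 j : Fin 2 →₀ ℕ) 1 = j := by
  simp

/-- The total degree of the exponent `(i, j)` (plumbing). [folklore] -/
private theorem degree_e₂₂ (i j : ℕ) : (Finsupp.single (0 : Fin 2) i + Finsupp.single 1 j : Fin 2 →₀ ℕ).degree = i + j := by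
  rw [map_add, Finsupp.degree_single, Finsupp.degree_single]

/-- Exponents `(i, j)` are determined by `i` and `j` (plumbing). [folklore] -/
private theorem e_eq_e_iff₂₂ {i j i' j' : ℕ} :
    (Finsupp.single (0 : Fin 2) i + Finsupp.single 1 j : Fin 2 →₀ ℕ) = Finsupp.single 0 i' + Finsupp.single 1 j' ↔
      i = i' ∧ j = j' := by
  constructor
  · intro h
    have h0 := DFunLike.congr_fun h 0
    have h1 := DFunLike.congr_fun h 1
    rw [e_apply_zero₂₂, e_apply_zero₂₂] at h0
    rw [e_apply_one₂₂, e_apply_one₂₂] at h1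
    exact ⟨h0, h1⟩
  · rintro ⟨rfl, rfl⟩
    rfl

/-- Every exponent of `k[x, y]` is an `(i, j)` (plumbing). [folklore] -/
private theorem eq_e₂₂ (d : Fin 2 →₀ ℕ) : d = Finsupp.single (0 : Fin 2) (d 0) + Finsupp.single 1 (d 1) := by
  ext i
  fin_cases i <;> simp

/-- The total degree of an exponent of `k[x, y]` (plumbing). [folklore] -/
private theorem degree_fin_two₂₂ (d : Fin 2 →₀ ℕ) : d.degree = d 0 + d 1 := by
  conv_lhs => rw [eq_e₂₂ d]
  rw [degree_e₂₂]

/-- `weight_{(P,Q)}(x^i y^j) = i P + j Q` (plumbing). [cite: AbramovichTemkinWlodarczyk2024, Rem. 2.4.2 (p. 1568)] -/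
private theorem weight_bentWeight₂₂ (P Q : ℕ) (d : Fin 2 →₀ ℕ) :
    Finsupp.weight (bentWeight P Q) d = d 0 * P + d 1 * Q := by
  have h10 : (1 : Fin 2) ≠ 0 := by decide
  conv_lhs => rw [eq_e₂₂ d]
  rw [map_add, Finsupp.weight_single, Finsupp.weight_single, smul_eq_mul, smul_eq_mul]
  simp only [bentWeight, ↓reduceIte, if_neg h10]

/-- The invariant of the two-weight centre `(1/a on y, 1/b on x)`, `a ≤ b` (plumbing). [folklore] -/
private theorem exps_singleWeights_add₂₂ {a b : ℕ} (ha : 0 < a) (hb : 0 < b) (hab : (a : ℚ) ≤ b) :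
    exps (singleWeights (1 : Fin 2) a + singleWeights (0 : Fin 2) b) = [(a : ℚ), (b : ℚ)] := by
  classical
  have hdisj : ∀ x : Fin 2, singleWeights (1 : Fin 2) a x = 0 ∨ singleWeights (0 : Fin 2) b x = 0 := by
    intro x
    by_cases hx : x = 0
    · subst hx; left; simp [singleWeights]
    · right; simp [singleWeights, hx]
  rw [exps_add_eq hdisj, exps_singleWeights 1 ha, exps_singleWeights 0 hb, List.singleton_append,
    List.insertionSort_cons, List.insertionSort_cons, List.insertionSort_nil, List.orderedInsert_nil,
    List.orderedInsert_cons_of_le _ _ hab]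

/-- The scaled weights of the two-weight centre (plumbing). [folklore] -/
private theorem scaled_bentWeight₂₂ (a b : ℕ) (ha : 0 < a) (hb : 0 < b) :
    ∀ i : Fin 2, ((bentWeight a b i : ℕ) : ℚ) =
      ((a * b : ℕ) : ℚ) * (singleWeights (1 : Fin 2) a + singleWeights (0 : Fin 2) b) i := by
  have h10 : (1 : Fin 2) ≠ 0 := by decide
  have h01 : (0 : Fin 2) ≠ 1 := by decide
  have haq : (a : ℚ) ≠ 0 := by exact_mod_cast ha.ne'
  have hbq : (b : ℚ) ≠ 0 := by exact_mod_cast hb.ne'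
  intro i
  fin_cases i
  · simp only [bentWeight, Fin.zero_eta, ↓reduceIte, Pi.add_apply, singleWeights, if_neg h01, zero_add, Nat.cast_mul]
    rw [mul_inv_cancel_right₀ hbq]
  · simp only [bentWeight, Fin.mk_one, if_neg h10, Pi.add_apply, singleWeights, ↓reduceIte, add_zero, Nat.cast_mul]
    rw [mul_comm ((a : ℕ) : ℚ), mul_inv_cancel_right₀ haq]

/-! ## §2 Bent polynomials with signed coefficients and their maximal invariant -/

/-- **Bent polynomials (signed).** `G ∈ k[x, y]` is `(p, r, K, a, v, ℓ)`-bent if `G = y^p + v x^K + ℓ x^a y + R` with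
every monomial `x^i y^j` of `R` satisfying `p i + K j ≥ p K + 2 r`, i.e. `ν_{(p,K)}(R) ≥ pK + 2r` (weights `p` on `x`,
`K` on `y`; `v, ℓ ∈ ℤ`). (defined here) [cite: CossartJannsenSaito2020, Def. 8.2 (1) / Thm. 8.16 (pp. 117–121)]
[cite: AbramovichTemkinWlodarczyk2024, Rem. 5.2.3 (p. 1576)] -/
def IsBentR (p r K a : ℕ) (v ℓ : ℤ) (G : MvPolynomial (Fin 2) k) : Prop :=
  ((p * K + 2 * r : ℕ) : ℕ∞) ≤
    monomialOrd (bentWeight p K) (G - (X 1 ^ p + C (v : k) * X 0 ^ K + C (ℓ : k) * (X 0 ^ a * X 1)))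

/-- The three named monomials, padded (plumbing). [folklore] -/
private theorem coreR_eq₂₂ (p K a : ℕ) (v ℓ : ℤ) :
    (X 0 ^ 0 * X 1 ^ p + C (v : k) * (X 0 ^ K * X 1 ^ 0) + C (ℓ : k) * (X 0 ^ a * X 1 ^ 1) : MvPolynomial (Fin 2) k) =
      X 1 ^ p + C (v : k) * X 0 ^ K + C (ℓ : k) * (X 0 ^ a * X 1) := by
  rw [pow_zero, one_mul, pow_zero, mul_one, pow_one]

section IsBentR

variable {p r K a : ℕ} {v ℓ : ℤ} {G : MvPolynomial (Fin 2) k}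

/-- The monomials of a bent polynomial: `y^p`, `x^K`, `x^a y`, or weight `≥ pK + 2r` (plumbing).
[cite: CossartJannsenSaito2020, Def. 8.2 (1) (pp. 117–118)] -/
private theorem IsBentR.mem_support (hb : IsBentR p r K a v ℓ G) {d : Fin 2 →₀ ℕ} (hd : d ∈ G.support) :
    d = Finsupp.single 0 0 + Finsupp.single 1 p ∨ d = Finsupp.single 0 K + Finsupp.single 1 0 ∨
      d = Finsupp.single 0 a + Finsupp.single 1 1 ∨ p * K + 2 * r ≤ d 0 * p + d 1 * K := by
  classical
  by_cases h : d ∈ (G - (X 1 ^ p + C (v : k) * X 0 ^ K + C (ℓ : k) * (X 0 ^ a * X 1))).support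
  · right; right; right
    have := (le_monomialOrd_iff _ _ _).1 hb d h
    rwa [weight_bentWeight₂₂] at this
  · rw [mem_support_iff, not_not, coeff_sub, sub_eq_zero, ← coreR_eq₂₂, coeff_add, coeff_add, coeff_C_mul, coeff_C_mul,
      coeff_X_pow_mul_X_pow₂₂, coeff_X_pow_mul_X_pow₂₂, coeff_X_pow_mul_X_pow₂₂] at h
    by_cases h1 : Finsupp.single (0 : Fin 2) 0 + Finsupp.single 1 p = d
    · exact Or.inl h1.symm
    by_cases h2 : Finsupp.single (0 : Fin 2) K + Finsupp.single 1 0 = d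
    · exact Or.inr (Or.inl h2.symm)
    by_cases h3 : Finsupp.single (0 : Fin 2) a + Finsupp.single 1 1 = d
    · exact Or.inr (Or.inr (Or.inl h3.symm))
    rw [if_neg h1, if_neg h2, if_neg h3, mul_zero, mul_zero, add_zero, add_zero] at h
    exact ((mem_support_iff.1 hd) h).elim

/-- The coefficient of `y^p` in a bent polynomial is `1` (plumbing). [cite: CossartJannsenSaito2020, Def. 8.2 (1)] -/
private theorem IsBentR.coeff_e₁ (hb : IsBentR p r K a v ℓ G) (hp : 2 ≤ p) (hr : 1 ≤ r) :
    G.coeff (Finsupp.single 0 0 + Finsupp.single 1 p) = 1 := by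
  classical
  have hnot : Finsupp.single (0 : Fin 2) 0 + Finsupp.single 1 p ∉
      (G - (X 1 ^ p + C (v : k) * X 0 ^ K + C (ℓ : k) * (X 0 ^ a * X 1))).support := by
    intro h
    have := (le_monomialOrd_iff _ _ _).1 hb _ h
    rw [weight_bentWeight₂₂, e_apply_zero₂₂, e_apply_one₂₂] at this
    nlinarith
  rw [mem_support_iff, not_not, coeff_sub, sub_eq_zero, ← coreR_eq₂₂, coeff_add, coeff_add, coeff_C_mul, coeff_C_mul,
    coeff_X_pow_mul_X_pow₂₂, coeff_X_pow_mul_X_pow₂₂, coeff_X_pow_mul_X_pow₂₂, if_pos rfl,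
    if_neg (fun h => by have := (e_eq_e_iff₂₂.1 h).2; omega),
    if_neg (fun h => by have := (e_eq_e_iff₂₂.1 h).2; omega)] at hnot
  rw [hnot]; ring

/-- The coefficient of the vertex `x^K` in a bent polynomial is `v` (plumbing). [cite: CossartJannsenSaito2020, Def. 8.2 (1)] -/
private theorem IsBentR.coeff_e₂ (hb : IsBentR p r K a v ℓ G) (hp : 2 ≤ p) (hr : 1 ≤ r) :
    G.coeff (Finsupp.single 0 K + Finsupp.single 1 0) = (v : k) := by
  classical
  have hnot : Finsupp.single (0 : Fin 2) K + Finsupp.single 1 0 ∉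
      (G - (X 1 ^ p + C (v : k) * X 0 ^ K + C (ℓ : k) * (X 0 ^ a * X 1))).support := by
    intro h
    have := (le_monomialOrd_iff _ _ _).1 hb _ h
    rw [weight_bentWeight₂₂, e_apply_zero₂₂, e_apply_one₂₂] at this
    nlinarith
  rw [mem_support_iff, not_not, coeff_sub, sub_eq_zero, ← coreR_eq₂₂, coeff_add, coeff_add, coeff_C_mul, coeff_C_mul,
    coeff_X_pow_mul_X_pow₂₂, coeff_X_pow_mul_X_pow₂₂, coeff_X_pow_mul_X_pow₂₂,
    if_neg (fun h => by have := (e_eq_e_iff₂₂.1 h).2; omega), if_pos rfl,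
    if_neg (fun h => by have := (e_eq_e_iff₂₂.1 h).2; omega)] at hnot
  rw [hnot]; ring

/-- `G = (y^p + v x^K + ℓ x^a y) + R` (plumbing). [folklore] -/
private theorem IsBentR.eq_core_add (G : MvPolynomial (Fin 2) k) (p K a : ℕ) (v ℓ : ℤ) :
    G = (X 0 ^ 0 * X 1 ^ p + C (v : k) * (X 0 ^ K * X 1 ^ 0) + C (ℓ : k) * (X 0 ^ a * X 1 ^ 1)) +
      (G - (X 1 ^ p + C (v : k) * X 0 ^ K + C (ℓ : k) * (X 0 ^ a * X 1))) := by
  ring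

/-- Every monomial of `R` has total degree `≥ p + 1` (since `K > p`) (plumbing).
[cite: AbramovichTemkinWlodarczyk2024, Rem. 5.2.3 (p. 1576)] -/
private theorem IsBentR.succ_le_monomialOrd_one (hb : IsBentR p r K a v ℓ G) (hr : 1 ≤ r) (hpK : p < K) :
    ((p + 1 : ℕ) : ℕ∞) ≤
      monomialOrd (fun _ => 1) (G - (X 1 ^ p + C (v : k) * X 0 ^ K + C (ℓ : k) * (X 0 ^ a * X 1))) := by
  rw [le_monomialOrd_one_iff]
  intro d hd
  have h := (le_monomialOrd_iff _ _ _).1 hb d hd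
  rw [weight_bentWeight₂₂] at h
  rw [degree_fin_two₂₂]
  have h1 : d 0 * p ≤ d 0 * K := Nat.mul_le_mul_left _ hpK.le
  have h2 : p * K < (d 0 + d 1) * K := by rw [add_mul]; omega
  have h3 : p < d 0 + d 1 := Nat.lt_of_mul_lt_mul_right h2
  omega

/-- **A bent polynomial has order `p`.** (derived here) [cite: AbramovichTemkinWlodarczyk2024, §5.1 (p. 1575) (a₁ = ord)] -/
theorem IsBentR.monomialOrd_one (hb : IsBentR p r K a v ℓ G) (hp : 2 ≤ p) (hr : 1 ≤ r) (hpK : p < K) (hpa : p ≤ a) :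
    monomialOrd (fun _ => 1) G = p := by
  classical
  apply le_antisymm
  · have hmem : Finsupp.single (0 : Fin 2) 0 + Finsupp.single 1 p ∈ G.support := by
      rw [mem_support_iff, hb.coeff_e₁ hp hr]; exact one_ne_zero
    refine (monomialOrd_le_weight (fun _ => 1) hmem).trans (le_of_eq ?_)
    rw [← Finsupp.degree_eq_weight_one, degree_e₂₂, zero_add]
  · rw [IsBentR.eq_core_add G p K a v ℓ]
    refine le_monomialOrd_add₂₂ _ (le_monomialOrd_add₂₂ _ (le_monomialOrd_add₂₂ _ ?_ (le_monomialOrd_C_mul₂₂ _ _ ?_))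
      (le_monomialOrd_C_mul₂₂ _ _ ?_)) (le_trans (by exact_mod_cast Nat.le_succ p) (hb.succ_le_monomialOrd_one hr hpK))
    all_goals rw [monomialOrd_X_pow_mul_X_pow₂₂, mul_one, mul_one]; exact_mod_cast (by omega)

/-- **The initial form of a bent polynomial is `y^p`** (`τ = 1`, directrix `{y = 0}`). (derived here)
[cite: CossartJannsenSaito2020, Def. 8.2 (1) (pp. 117–118)] -/
theorem IsBentR.homogeneousComponent_eq (hb : IsBentR p r K a v ℓ G) (hr : 1 ≤ r) (hpK : p < K) (hpa : p ≤ a) :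
    homogeneousComponent p G = X 1 ^ p := by
  classical
  have hc : ∀ i j : ℕ, homogeneousComponent p (X 0 ^ i * X 1 ^ j : MvPolynomial (Fin 2) k) =
      if p = i + j then X 0 ^ i * X 1 ^ j else 0 := fun i j =>
    homogeneousComponent_of_mem ((isHomogeneous_X_pow (0 : Fin 2) i).mul (isHomogeneous_X_pow 1 j))
  have hR : homogeneousComponent p (G - (X 1 ^ p + C (v : k) * X 0 ^ K + C (ℓ : k) * (X 0 ^ a * X 1))) = 0 :=
    homogeneousComponent_eq_zero_of_lt_monomialOrd _ (Nat.lt_succ_self p) (hb.succ_le_monomialOrd_one hr hpK)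
  rw [IsBentR.eq_core_add G p K a v ℓ, map_add, hR, add_zero, map_add, map_add, homogeneousComponent_C_mul,
    homogeneousComponent_C_mul, hc, hc, hc, if_pos (zero_add p).symm, if_neg (by omega), if_neg (by omega)]
  simp

/-- **`(p, K) ∈ W(G)` for a bent `G`**: the weights `1/K` on `x`, `1/p` on `y` (no coordinate change) are admissible.
(derived here) [cite: AbramovichTemkinWlodarczyk2024, Thm. 5.3.1 (2) (p. 1578), Lemma 5.2.6 (p. 1576)] -/
theorem IsBentR.mem_admissibleInvariants (hb : IsBentR p r K a v ℓ G) (hp : 2 ≤ p) (hpK : p ≤ K)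
    (hrel : p * a + K = p * K + r) : [(p : ℚ), (K : ℚ)] ∈ admissibleInvariants G := by
  classical
  have hp0 : 0 < p := by omega
  have hK0 : 0 < K := by omega
  have h10 : (1 : Fin 2) ≠ 0 := by decide
  have hcentre : IsCentreFor G (AlgEquiv.refl : MvPolynomial (Fin 2) k ≃ₐ[k] MvPolynomial (Fin 2) k)
      (singleWeights (1 : Fin 2) p + singleWeights (0 : Fin 2) K) := by
    refine ⟨fun i => ?_, fun x => ?_, ?_⟩
    · change constantCoeff (X i : MvPolynomial (Fin 2) k) = 0
      exact constantCoeff_X k i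
    · simp only [Pi.add_apply, singleWeights]
      split_ifs <;> positivity
    · change IsAdmissibleFor _ G
      rw [isAdmissibleFor_iff_le_monomialOrd _ (bentWeight p K) (N := p * K) (by positivity)
        (scaled_bentWeight₂₂ p K hp0 hK0), IsBentR.eq_core_add G p K a v ℓ]
      refine le_monomialOrd_add₂₂ _ (le_monomialOrd_add₂₂ _ (le_monomialOrd_add₂₂ _ ?_ (le_monomialOrd_C_mul₂₂ _ _ ?_))
        (le_monomialOrd_C_mul₂₂ _ _ ?_)) (le_trans (by exact_mod_cast (by omega : p * K ≤ p * K + 2 * r)) hb)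
      all_goals
        rw [monomialOrd_X_pow_mul_X_pow₂₂]
        simp only [bentWeight, ↓reduceIte, if_neg h10]
        exact_mod_cast (by nlinarith)
  have h := exps_mem_admissibleInvariants hcentre
  rwa [exps_singleWeights_add₂₂ hp0 hK0 (by exact_mod_cast hpK)] at h

/-- **`δ(G; x; y) = K/p` for a bent `G` with `v ≠ 0` in `k`**: the vertex `x^K` gives `K/p`, `x^a y` gives
`a/(p − 1) ≥ K/p` (`p a = (p − 1) K + r`), and a monomial with `p i + K j ≥ pK + 2r`, `j < p`, gives `i/(p − j) ≥ K/p`.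
(derived here) [cite: CossartJannsenSaito2020, Def. 8.1 (3) / Def. 8.2 (1) (pp. 117–118)] -/
theorem IsBentR.hironakaDelta_eq (hb : IsBentR p r K a v ℓ G) (hp : 2 ≤ p) (hr : 1 ≤ r)
    (hrel : p * a + K = p * K + r) (hv : ((v : ℤ) : k) ≠ 0) :
    hironakaDelta ({1} : Finset (Fin 2)) p G = ((((K : ℕ) : ℚ) / (p : ℚ) : ℚ) : WithTop ℚ) := by
  classical
  have hp0 : 0 < p := by omega
  have hp1 : 1 < p := by omega
  have hp0q : (0 : ℚ) < p := by exact_mod_cast hp0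
  have hp1q : (1 : ℚ) < p := by exact_mod_cast hp1
  have hpsub : (((p - 1 : ℕ) : ℚ)) = (p : ℚ) - 1 := by rw [Nat.cast_sub hp1.le, Nat.cast_one]
  have hrelq : ((p : ℚ) * a + K) = p * K + r := by exact_mod_cast hrel
  have hrq : (1 : ℚ) ≤ r := by exact_mod_cast hr
  apply le_antisymm
  · unfold hironakaDelta
    have hmem : Finsupp.single (0 : Fin 2) K + Finsupp.single 1 0 ∈ G.support := by
      rw [mem_support_iff, hb.coeff_e₂ hp hr]; exact hv
    refine (Finset.inf_le (Finset.mem_filter.2 ⟨hmem, ?_⟩)).trans (le_of_eq ?_)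
    · rw [blockDeg_singleton, e_apply_one₂₂]; exact hp0
    · rw [coDeg_singleton, blockDeg_singleton, degree_e₂₂, e_apply_one₂₂, Nat.add_zero, Nat.sub_zero, Nat.sub_zero]
  · rw [le_hironakaDelta_iff]
    intro d hd hb1
    rw [blockDeg_singleton] at hb1
    rw [coDeg_singleton, blockDeg_singleton, degree_fin_two₂₂, Nat.add_sub_cancel]
    rcases hb.mem_support hd with rfl | rfl | rfl | h
    · exfalso
      rw [e_apply_one₂₂] at hb1
      exact lt_irrefl _ hb1
    · rw [e_apply_zero₂₂, e_apply_one₂₂, Nat.sub_zero]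
    · rw [e_apply_zero₂₂, e_apply_one₂₂, hpsub, div_le_div_iff₀ hp0q (by linarith)]
      nlinarith
    · have hlt : ((d 1 : ℕ) : ℚ) < p := by exact_mod_cast hb1
      have hq : ((p * K + 2 * r : ℕ) : ℚ) ≤ ((d 0 * p + d 1 * K : ℕ) : ℚ) := by exact_mod_cast h
      push_cast at hq
      rw [Nat.cast_sub hb1.le, div_le_div_iff₀ hp0q (by linarith)]
      nlinarith

/-- **A signed bent polynomial has `max W(G) = (p, K)`** (`2 ≤ p < K`, `1 ≤ r`, `p a + K = p K + r`, `p ∤ K`, `v ≠ 0` in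
`k`; any field), by the two-variable vertex bound (`ord = p`, `in_p = y^p`, `δ = K/p ∉ ℕ`). (derived here)
[cite: CossartJannsenSaito2020, Thm. 8.16 (p. 121)] [cite: AbramovichTemkinWlodarczyk2024, Thm. 5.1.1 / §5.3 (pp. 1575–1578)] -/
theorem IsBentR.isMaxInv (hb : IsBentR p r K a v ℓ G) (hp : 2 ≤ p) (hr : 1 ≤ r) (hpK : p < K)
    (hrel : p * a + K = p * K + r) (hdiv : ¬ p ∣ K) (hv : ((v : ℤ) : k) ≠ 0) :
    IsMaxInv (admissibleInvariants G) [(p : ℚ), (K : ℚ)] := by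
  have hpa : p ≤ a := by
    by_contra hlt
    have h1 : a + 1 ≤ p := by omega
    have h2 : p * (a + 1) ≤ p * p := Nat.mul_le_mul_left _ h1
    nlinarith
  refine ⟨hb.mem_admissibleInvariants hp hpK.le hrel, fun c hc => ?_⟩
  exact not_lt_of_mem_admissibleInvariants_of_vertex₂ (by omega) (hb.monomialOrd_one hp hr hpK hpa)
    (hb.homogeneousComponent_eq hr hpK hpa) (hb.hironakaDelta_eq hp hr hrel hv)
    (isDeltaPrepared_of_hironakaDelta_eq_div (by omega) (hb.hironakaDelta_eq hp hr hrel hv) hdiv) hc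

end IsBentR

/-! ## §3 The substitution `x ↦ x^p, y ↦ y − c x^K` maps bent to bent -/

/-- **The substitution `T_{K,c} : x ↦ x^p, y ↦ y − c x^K`** (an algebra endomorphism of `k[x, y]`).
[cite: CossartJannsenSaito2020, Thm. 8.16 (p. 121) (vertex preparation y ↦ y + λ u^A)] [cite: Hauser2010, §D (p. 12)] -/
def bendSubstC (p K : ℕ) (c : k) : MvPolynomial (Fin 2) k →ₐ[k] MvPolynomial (Fin 2) k :=
  aeval ![X 0 ^ p, X 1 - C c * X 0 ^ K]

/-- `T_{K,c}(x) = x^p`. (derived here) [cite: CossartJannsenSaito2020, Thm. 8.16 (p. 121)] -/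
@[simp] theorem bendSubstC_X_zero (p K : ℕ) (c : k) : bendSubstC p K c (X 0 : MvPolynomial (Fin 2) k) = X 0 ^ p := by
  simp [bendSubstC]

/-- `T_{K,c}(y) = y − c x^K`. (derived here) [cite: CossartJannsenSaito2020, Thm. 8.16 (p. 121)] -/
@[simp] theorem bendSubstC_X_one (p K : ℕ) (c : k) :
    bendSubstC p K c (X 1 : MvPolynomial (Fin 2) k) = X 1 - C c * X 0 ^ K := by
  simp [bendSubstC]

/-- **Domination: `ν_{(p, K')}(T_{K,c} R) ≥ ν_{(p², pK)}(R)`** for `pK ≤ K'`. (derived here)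
[cite: AbramovichTemkinWlodarczyk2024, Def. 2.4.1 (2) / Rem. 5.2.3 (pp. 1568, 1576) (domination)] -/
theorem monomialOrd_le_monomialOrd_bendSubstC (p K K' : ℕ) (c : k) (hK' : p * K ≤ K') (R : MvPolynomial (Fin 2) k) :
    monomialOrd (bentWeight (p * p) (p * K)) R ≤ monomialOrd (bentWeight p K') (bendSubstC p K c R) := by
  have h10 : (1 : Fin 2) ≠ 0 := by decide
  have hX0 : ((bentWeight (p * p) (p * K) 0 : ℕ) : ℕ∞) ≤
      ((monomialAddVal (bentWeight p K')).comap (bendSubstC (k := k) p K c).toRingHom) (X 0) := by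
    change ((bentWeight (p * p) (p * K) 0 : ℕ) : ℕ∞) ≤ monomialOrd (bentWeight p K') (bendSubstC p K c (X 0))
    rw [bendSubstC_X_zero, monomialOrd_X_pow₂₂]
    simp only [bentWeight, ↓reduceIte, le_refl]
  have hX1 : ((bentWeight (p * p) (p * K) 1 : ℕ) : ℕ∞) ≤
      ((monomialAddVal (bentWeight p K')).comap (bendSubstC (k := k) p K c).toRingHom) (X 1) := by
    change ((bentWeight (p * p) (p * K) 1 : ℕ) : ℕ∞) ≤ monomialOrd (bentWeight p K') (bendSubstC p K c (X 1))
    rw [bendSubstC_X_one]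
    refine le_monomialOrd_sub₂₂ _ ?_ (le_monomialOrd_C_mul₂₂ _ _ ?_)
    · rw [monomialOrd_X]
      simp only [bentWeight, if_neg h10]
      exact_mod_cast hK'
    · rw [monomialOrd_X_pow₂₂]
      simp only [bentWeight, if_neg h10, ↓reduceIte]
      exact_mod_cast (le_of_eq (mul_comm p K))
  have hX : ∀ i, ((bentWeight (p * p) (p * K) i : ℕ) : ℕ∞) ≤
      ((monomialAddVal (bentWeight p K')).comap (bendSubstC (k := k) p K c).toRingHom) (X i) :=
    Fin.forall_fin_two.2 ⟨hX0, hX1⟩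
  exact monomialOrd_le_addValuation _ _ hX R

section Step

variable {p r K a : ℕ} {v ℓ : ℤ} {G : MvPolynomial (Fin 2) k}

/-- **The bending step (signed).** In characteristic `p`, `T_{K,v}` maps a `(p, r, K, a, v, ℓ)`-bent `G` to the
`(p, r, pK + r, pa, −ℓ v, ℓ)`-bent `T_{K,v} G = G(x^p, y − v x^K)`: `(y − v x^K)^p + v x^{pK} = y^p` (`v^p = v` for
`v ∈ ℤ`), `ℓ x^{pa}(y − v x^K) = ℓ x^{pa} y − ℓ v x^{pK + r}`, and the remainder by domination. (derived here)
[cite: CossartJannsenSaito2020, Def. 8.8 / Thm. 8.16 (pp. 119–121)] [cite: Hauser2010, §D (p. 12)]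
[cite: AbramovichTemkinWlodarczyk2024, Rem. 5.2.3 (p. 1576)] -/
theorem IsBentR.step [hp : Fact p.Prime] [CharP k p] (hb : IsBentR p r K a v ℓ G) (hrel : p * a + K = p * K + r) :
    IsBentR p r (p * K + r) (p * a) (-(ℓ * v)) ℓ (bendSubstC p K (v : k) G) := by
  classical
  haveI : ExpChar (MvPolynomial (Fin 2) k) p := ExpChar.prime hp.out
  have hp2 : 2 ≤ p := hp.out.two_le
  have hfrob : ((v : ℤ) : k) ^ p = (v : k) := by rw [← frobenius_def, map_intCast]
  have hX : (X 0 : MvPolynomial (Fin 2) k) ^ (p * a) * X 0 ^ K = X 0 ^ (p * K + r) := by rw [← pow_add, hrel]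
  have hkey : bendSubstC p K (v : k) G -
      (X 1 ^ p + C ((-(ℓ * v) : ℤ) : k) * X 0 ^ (p * K + r) + C (ℓ : k) * (X 0 ^ (p * a) * X 1)) =
      bendSubstC p K (v : k) (G - (X 1 ^ p + C (v : k) * X 0 ^ K + C (ℓ : k) * (X 0 ^ a * X 1))) := by
    rw [map_sub (bendSubstC p K (v : k)) G, map_add, map_add, map_pow, map_mul, map_mul, map_mul, map_pow, map_pow,
      bendSubstC_X_zero, bendSubstC_X_one, algHom_C, algHom_C, algebraMap_eq, sub_pow_expChar, mul_pow, ← map_pow C, hfrob,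
      ← pow_mul, ← pow_mul, ← pow_mul, mul_comm K p, ← hX, Int.cast_neg, Int.cast_mul, map_neg, map_mul]
    ring
  unfold IsBentR
  rw [hkey]
  have h2 : ((p * (p * K + 2 * r) : ℕ) : ℕ∞) ≤
      monomialOrd (bentWeight (p * p) (p * K)) (G - (X 1 ^ p + C (v : k) * X 0 ^ K + C (ℓ : k) * (X 0 ^ a * X 1))) := by
    rw [le_monomialOrd_iff]
    intro d hd
    have h := (le_monomialOrd_iff _ _ _).1 hb d hd
    rw [weight_bentWeight₂₂] at h ⊢
    nlinarith
  calc ((p * (p * K + r) + 2 * r : ℕ) : ℕ∞) ≤ ((p * (p * K + 2 * r) : ℕ) : ℕ∞) := by exact_mod_cast (by nlinarith)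
    _ ≤ _ := h2
    _ ≤ _ := monomialOrd_le_monomialOrd_bendSubstC p K (p * K + r) _ (Nat.le_add_right _ _) _

end Step

/-! ## §4 The first rung: a second-order Taylor formula for `(y − x)^{s+1}` -/

/-- **`(y − x)^{s+1} = (−1)^{s+1} x^{s+1} + (s+1)(−1)^s x^s y + P` with `P ∈ (y²)` of order `≥ s + 1`** (induction on
`s`; no binomial coefficients beyond the linear term are needed). (derived here) [folklore]
[cite: CossartJannsenSaito2020, Def. 8.2 (1) (p. 118) (the u-linear part of the prepared form)] -/
theorem exists_sub_pow_taylor₂ (s : ℕ) : ∃ P : MvPolynomial (Fin 2) k,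
    (X 1 - X 0 : MvPolynomial (Fin 2) k) ^ (s + 1) =
      (-1) ^ (s + 1) * X 0 ^ (s + 1) + ((s + 1 : ℕ) : MvPolynomial (Fin 2) k) * (-1) ^ s * X 0 ^ s * X 1 + P ∧
    ((s + 1 : ℕ) : ℕ∞) ≤ monomialOrd (fun _ => 1) P ∧ (2 : ℕ∞) ≤ monomialOrd (bentWeight 0 1) P := by
  have h10 : (1 : Fin 2) ≠ 0 := by decide
  induction s with
  | zero =>
    refine ⟨0, ?_, ?_, ?_⟩
    · push_cast; ring
    · rw [monomialOrd_zero]; exact le_top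
    · rw [monomialOrd_zero]; exact le_top
  | succ s ih =>
    obtain ⟨P, hP, h1, h2⟩ := ih
    refine ⟨((s + 1 : ℕ) : MvPolynomial (Fin 2) k) * (-1) ^ s * X 0 ^ s * X 1 ^ 2 + P * (X 1 - X 0), ?_, ?_, ?_⟩
    · rw [pow_succ, hP]; push_cast; ring
    · refine le_monomialOrd_add₂₂ _ ?_ ?_
      · have h := le_monomialOrd_mul₂₂ (fun _ : Fin 2 => 1)
          (le_monomialOrd_mul₂₂ (fun _ : Fin 2 => 1)
            (le_monomialOrd_mul₂₂ (fun _ : Fin 2 => 1)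
              (zero_le_monomialOrd₂₂ (fun _ : Fin 2 => 1) (((s + 1 : ℕ) : MvPolynomial (Fin 2) k)))
              (zero_le_monomialOrd₂₂ (fun _ : Fin 2 => 1) ((-1 : MvPolynomial (Fin 2) k) ^ s)))
            (le_of_eq (monomialOrd_X_pow₂₂ (k := k) (fun _ => 1) 0 s).symm))
          (le_of_eq (monomialOrd_X_pow₂₂ (k := k) (fun _ => 1) 1 2).symm)
        refine le_trans ?_ h
        rw [mul_one, mul_one, zero_add, zero_add]
        exact_mod_cast (by omega)
      · have h := le_monomialOrd_mul₂₂ (fun _ : Fin 2 => 1) h1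
          (le_monomialOrd_sub₂₂ (fun _ : Fin 2 => 1) (A := (X 1 : MvPolynomial (Fin 2) k)) (B := X 0) (n := 1)
            (by rw [monomialOrd_X]; exact_mod_cast le_rfl) (by rw [monomialOrd_X]; exact_mod_cast le_rfl))
        refine le_trans ?_ h
        exact_mod_cast le_rfl
    · refine le_monomialOrd_add₂₂ _ ?_ ?_
      · have h := le_monomialOrd_mul₂₂ (bentWeight 0 1)
          (le_monomialOrd_mul₂₂ (bentWeight 0 1)
            (le_monomialOrd_mul₂₂ (bentWeight 0 1)
              (zero_le_monomialOrd₂₂ (bentWeight 0 1) (((s + 1 : ℕ) : MvPolynomial (Fin 2) k)))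
              (zero_le_monomialOrd₂₂ (bentWeight 0 1) ((-1 : MvPolynomial (Fin 2) k) ^ s)))
            (zero_le_monomialOrd₂₂ (bentWeight 0 1) ((X 0 : MvPolynomial (Fin 2) k) ^ s)))
          (le_of_eq (monomialOrd_X_pow₂₂ (k := k) (bentWeight 0 1) 1 2).symm)
        refine le_trans ?_ h
        simp only [bentWeight, if_neg h10, zero_add, mul_one]
        exact_mod_cast le_rfl
      · have h := le_monomialOrd_mul₂₂ (bentWeight 0 1) h2
          (zero_le_monomialOrd₂₂ (bentWeight 0 1) ((X 1 - X 0 : MvPolynomial (Fin 2) k)))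
        refine le_trans ?_ h
        rw [add_zero]

/-! ## §5 The ladder `K_e(r)`, the signs `v_e`, the shifts `γ_e` and the bent forms `G_e` -/

/-- **`K_e(r)`**: `K_0 = 1`, `K_{e+1} = p K_e + r` (`K_e = p^e + r (1 + p + ⋯ + p^{e−1})`).
[cite: Hauser2010, §D (p. 12)] [cite: HauserPerlega2019PRIMS, §7 (p. 798)] -/
def bendKR (p r : ℕ) : ℕ → ℕ
  | 0 => 1
  | e + 1 => p * bendKR p r e + r

/-- `K_0 = 1`. (derived here) [cite: Hauser2010, §D (p. 12)] -/
@[simp] theorem bendKR_zero (p r : ℕ) : bendKR p r 0 = 1 := rfl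

/-- `K_{e+1} = p K_e + r`. (derived here) [cite: Hauser2010, §D (p. 12)] -/
@[simp] theorem bendKR_succ (p r e : ℕ) : bendKR p r (e + 1) = p * bendKR p r e + r := rfl

/-- **`K_e(r) = p^e + r Σ_{i<e} p^i`.** (derived here) [cite: Hauser2010, §D (p. 12)] -/
theorem bendKR_eq (p r e : ℕ) : bendKR p r e = p ^ e + r * ∑ i ∈ Finset.range e, p ^ i := by
  induction e with
  | zero => simp
  | succ e ih =>
    rw [bendKR_succ, ih, Finset.sum_range_succ', pow_zero]
    have h : ∑ i ∈ Finset.range e, p ^ (i + 1) = p * ∑ i ∈ Finset.range e, p ^ i := by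
      rw [Finset.mul_sum]
      exact Finset.sum_congr rfl fun i _ => by ring
    rw [h]
    ring

/-- `K_e(1)` is the `K_e` of `WeightedCentreBendingLadder`. (derived here) [cite: Hauser2010, §D (p. 12)] -/
theorem bendKR_one_eq_bendK (p e : ℕ) : bendKR p 1 e = bendK p e := by
  induction e with
  | zero => rfl
  | succ e ih => rw [bendKR_succ, bendK_succ, ih]

/-- `K_e ≥ 1`. (derived here) [cite: Hauser2010, §D (p. 12)] -/
theorem bendKR_pos {p : ℕ} (hp : 1 ≤ p) (r e : ℕ) : 0 < bendKR p r e := by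
  induction e with
  | zero => exact Nat.one_pos
  | succ e ih =>
    rw [bendKR_succ]
    have := Nat.mul_le_mul hp ih
    omega

/-- `p < K_e` for `e ≥ 1`, `r ≥ 1`. (derived here) [cite: Hauser2010, §D (p. 12)] -/
theorem lt_bendKR {p r e : ℕ} (hp : 1 ≤ p) (hr : 1 ≤ r) (he : 1 ≤ e) : p < bendKR p r e := by
  obtain ⟨e, rfl⟩ : ∃ e', e = e' + 1 := ⟨e - 1, by omega⟩
  rw [bendKR_succ]
  have := Nat.mul_le_mul_left p (bendKR_pos hp r e)
  omega

/-- `p ∤ K_e` for `e ≥ 1` (`K_e ≡ r mod p`, `p ∤ r`). (derived here) [cite: Hauser2010, §D (p. 12)] -/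
theorem not_dvd_bendKR {p r e : ℕ} (hr : ¬ p ∣ r) (he : 1 ≤ e) : ¬ p ∣ bendKR p r e := by
  obtain ⟨e, rfl⟩ : ∃ e', e = e' + 1 := ⟨e - 1, by omega⟩
  rw [bendKR_succ]
  intro h
  exact hr ((Nat.dvd_add_right ⟨bendKR p r e, rfl⟩).1 h)

/-- **The vertex signs `v_e ∈ ℤ`**: `v_0 = 1` (the shift `y ↦ y − x` producing the first rung), `v_1 = (−1)^{r+1}`,
`v_{e+2} = −((−1)^r r) v_{e+1}` (the bending step with `ℓ = (−1)^r r`). (defined here) [cite: Hauser2010, §D (p. 12)] -/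
def bendV (r : ℕ) : ℕ → ℤ
  | 0 => 1
  | 1 => (-1) ^ (r + 1)
  | e + 2 => -(((-1) ^ r * r : ℤ) * bendV r (e + 1))

/-- `v_0 = 1`. (derived here) [cite: Hauser2010, §D (p. 12)] -/
@[simp] theorem bendV_zero (r : ℕ) : bendV r 0 = 1 := rfl

/-- `v_1 = (−1)^{r+1}`. (derived here) [cite: Hauser2010, §D (p. 12)] -/
@[simp] theorem bendV_one (r : ℕ) : bendV r 1 = (-1) ^ (r + 1) := rfl

/-- `v_{e+2} = −((−1)^r r) v_{e+1}`. (derived here) [cite: Hauser2010, §D (p. 12)] -/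
theorem bendV_succ_succ (r e : ℕ) : bendV r (e + 2) = -(((-1) ^ r * r : ℤ) * bendV r (e + 1)) := rfl

/-- `v_{e+1} = −ℓ v_e` for `e ≥ 1`, `ℓ = (−1)^r r`. (derived here) [cite: Hauser2010, §D (p. 12)] -/
theorem bendV_succ {r e : ℕ} (he : 1 ≤ e) : bendV r (e + 1) = -(((-1) ^ r * r : ℤ) * bendV r e) := by
  obtain ⟨e, rfl⟩ : ∃ e', e = e' + 1 := ⟨e - 1, by omega⟩
  rfl

/-- **`v_e ≠ 0` in `k`** when `p ∤ r` (`v_e = ± r^{e−1}`). (derived here) [cite: Hauser2010, §D (p. 12)] -/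
theorem cast_bendV_ne_zero (p : ℕ) [CharP k p] {r : ℕ} (hr : ¬ p ∣ r) (e : ℕ) : ((bendV r e : ℤ) : k) ≠ 0 := by
  have hrk : ((r : ℕ) : k) ≠ 0 := fun h => hr ((CharP.cast_eq_zero_iff k p r).1 h)
  induction e using Nat.strong_induction_on with
  | _ e ih =>
    match e with
    | 0 => simp
    | 1 => simp
    | e + 2 =>
      rw [bendV_succ_succ]
      push_cast
      exact neg_ne_zero.2 (mul_ne_zero (mul_ne_zero (pow_ne_zero _ (neg_ne_zero.2 one_ne_zero)) hrk)
        (ih (e + 1) (by omega)))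

/-- **The shift `γ_e ∈ k[x]`**: `γ_0 = 0`, `γ_{e+1} = T_{K_e, v_e} γ_e + v_e x^{K_e}`; so `γ_1 = x`,
`γ_2 = x^p + (−1)^{r+1} x^{p+r}`, …. (defined here)
[cite: CossartJannsenSaito2020, Def. 8.8 / Thm. 8.16 (pp. 119–121)] [cite: Hauser2010, §D (p. 12)] -/
def bendShiftR (k : Type*) [Field k] (p r : ℕ) : ℕ → MvPolynomial (Fin 2) k
  | 0 => 0
  | e + 1 => bendSubstC p (bendKR p r e) ((bendV r e : ℤ) : k) (bendShiftR k p r e) +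
      C ((bendV r e : ℤ) : k) * X 0 ^ bendKR p r e

/-- `γ_0 = 0`. (derived here) [cite: Hauser2010, §D (p. 12)] -/
@[simp] theorem bendShiftR_zero (p r : ℕ) : bendShiftR k p r 0 = 0 := rfl

/-- `γ_{e+1} = T_{K_e, v_e} γ_e + v_e x^{K_e}`. (derived here) [cite: Hauser2010, §D (p. 12)] -/
theorem bendShiftR_succ (p r e : ℕ) : bendShiftR k p r (e + 1) =
    bendSubstC p (bendKR p r e) ((bendV r e : ℤ) : k) (bendShiftR k p r e) + C ((bendV r e : ℤ) : k) * X 0 ^ bendKR p r e :=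
  rfl

/-- `γ_1 = x`. (derived here) [cite: Hauser2010, §D (p. 12)] -/
theorem bendShiftR_one (p r : ℕ) : bendShiftR k p r 1 = X 0 := by
  rw [bendShiftR_succ, bendShiftR_zero, map_zero, zero_add, bendKR_zero, pow_one, bendV_zero, Int.cast_one, C_1, one_mul]

/-- `γ_e` does not involve `y`. (derived here) [cite: CossartJannsenSaito2020, Thm. 8.16 (p. 121) (y ↦ y + q(u))] -/
theorem one_notMem_vars_bendShiftR (p r e : ℕ) : (1 : Fin 2) ∉ (bendShiftR k p r e).vars := by
  classical
  have h10 : (1 : Fin 2) ≠ 0 := by decide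
  induction e with
  | zero => simp
  | succ e ih =>
    intro h
    rw [bendShiftR_succ] at h
    rcases Finset.mem_union.1 (vars_add_subset _ _ h) with h | h
    · rw [bendSubstC, aeval_eq_bind₁] at h
      obtain ⟨i, hi, h1⟩ := Finset.mem_biUnion.1 (vars_bind₁ _ _ h)
      fin_cases i
      · simp only [Fin.zero_eta, Matrix.cons_val_zero] at h1
        exact h10 (by simpa [vars_X] using vars_pow _ _ h1)
      · exact ih hi
    · have h' := vars_mul _ _ h
      rw [Finset.mem_union] at h'
      rcases h' with h' | h'
      · rw [vars_C] at h'
        exact Finset.notMem_empty _ h'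
      · exact h10 (by simpa [vars_X] using vars_pow _ _ h')

/-- `γ_e` vanishes at the origin: `ord γ_e ≥ 1`. (derived here) [cite: AbramovichTemkinWlodarczyk2024, Rem. 5.2.3 (p. 1576)] -/
theorem one_le_monomialOrd_one_bendShiftR {p : ℕ} (hp : p ≠ 0) (r e : ℕ) :
    (1 : ℕ∞) ≤ monomialOrd (fun _ => 1) (bendShiftR k p r e) := by
  have hp1 : 1 ≤ p := Nat.one_le_iff_ne_zero.2 hp
  induction e with
  | zero => rw [bendShiftR_zero, monomialOrd_zero]; exact le_top
  | succ e ih =>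
    rw [bendShiftR_succ]
    refine le_monomialOrd_add₂₂ _ ?_ (le_monomialOrd_C_mul₂₂ _ _ ?_)
    · refine ih.trans (monomialOrd_le_monomialOrd_map (fun _ => 1)
        (bendSubstC (k := k) p (bendKR p r e) ((bendV r e : ℤ) : k)).toRingHom (fun i => ?_) _)
      change ((1 : ℕ) : ℕ∞) ≤ monomialOrd (fun _ => 1) (bendSubstC p (bendKR p r e) ((bendV r e : ℤ) : k) (X i))
      fin_cases i
      · rw [Fin.zero_eta, bendSubstC_X_zero, monomialOrd_X_pow₂₂, mul_one]
        exact_mod_cast hp1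
      · rw [Fin.mk_one, bendSubstC_X_one]
        refine le_monomialOrd_sub₂₂ _ ?_ (le_monomialOrd_C_mul₂₂ _ _ ?_)
        · rw [monomialOrd_X]
        · rw [monomialOrd_X_pow₂₂, mul_one]
          exact_mod_cast bendKR_pos hp1 r e
    · rw [monomialOrd_X_pow₂₂, mul_one]
      exact_mod_cast bendKR_pos hp1 r e

/-- `γ_e(0) = 0`. (derived here) [cite: AbramovichTemkinWlodarczyk2024, Rem. 5.2.3 (p. 1576)] -/
theorem constantCoeff_bendShiftR {p : ℕ} (hp : p ≠ 0) (r e : ℕ) : constantCoeff (bendShiftR k p r e) = 0 := by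
  by_contra h
  have h0 := monomialOrd_eq_zero_of_constantCoeff_ne_zero (fun _ => (1 : ℕ)) h
  have h1 := one_le_monomialOrd_one_bendShiftR (k := k) hp r e
  rw [h0] at h1
  exact absurd h1 (by decide)

/-- **The bent form `G_e = F_e(x, y − γ_e)`** of `F_e = x^{p^e} + y^p + y^{p+r}`. (defined here)
[cite: CossartJannsenSaito2020, Def. 8.2 / Thm. 8.16 (p. 121)] [cite: Hauser2010, §D (p. 12)] -/
def bendFormR (k : Type*) [Field k] (p r e : ℕ) : MvPolynomial (Fin 2) k :=
  (addPolyShear 1 (bendShiftR k p r e)).symm (X 0 ^ p ^ e + (X 1 ^ p + X 1 ^ (p + r)))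

/-- `G_e = x^{p^e} + (y − γ_e)^p + (y − γ_e)^{p+r}`. (derived here) [cite: CossartJannsenSaito2020, Def. 8.2 (p. 118)] -/
theorem bendFormR_eq (p r e : ℕ) : bendFormR k p r e =
    X 0 ^ p ^ e + ((X 1 - bendShiftR k p r e) ^ p + (X 1 - bendShiftR k p r e) ^ (p + r)) := by
  classical
  have h01 : (0 : Fin 2) ≠ 1 := by decide
  have hsymm1 : (addPolyShear 1 (bendShiftR k p r e)).symm (X 1 : MvPolynomial (Fin 2) k) = X 1 - bendShiftR k p r e := by
    rw [addPolyShear_symm_X_self₂₂, killVar_eq_self_of_notMem (one_notMem_vars_bendShiftR (k := k) p r e)]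
  have hsymm0 : (addPolyShear 1 (bendShiftR k p r e)).symm (X 0 : MvPolynomial (Fin 2) k) = X 0 :=
    addPolyShear_symm_X_of_ne₂₂ 1 _ h01
  rw [bendFormR, map_add, map_add, map_pow, map_pow, map_pow, hsymm0, hsymm1]

/-- **The recursion `G_{e+1} = T_{K_e, v_e} G_e`.** (derived here)
[cite: CossartJannsenSaito2020, Thm. 8.16 (p. 121) (vertex preparation, one vertex at a time)] [cite: Hauser2010, §D (p. 12)] -/
theorem bendFormR_succ (p r e : ℕ) :
    bendFormR k p r (e + 1) = bendSubstC p (bendKR p r e) ((bendV r e : ℤ) : k) (bendFormR k p r e) := by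
  rw [bendFormR_eq, bendFormR_eq, map_add, map_add, map_pow, map_pow, map_pow, map_sub, bendSubstC_X_zero,
    bendSubstC_X_one, bendShiftR_succ, pow_succ' p e, pow_mul]
  have hsub : (X 1 - (bendSubstC p (bendKR p r e) ((bendV r e : ℤ) : k) (bendShiftR k p r e) +
      C ((bendV r e : ℤ) : k) * X 0 ^ bendKR p r e) : MvPolynomial (Fin 2) k) =
      X 1 - C ((bendV r e : ℤ) : k) * X 0 ^ bendKR p r e - bendSubstC p (bendKR p r e) ((bendV r e : ℤ) : k)
        (bendShiftR k p r e) := by ring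
  rw [hsub]

/-- `W(G_e) = W(x^{p^e} + y^p + y^{p+r})` (origin-fixing coordinate change). (derived here)
[cite: AbramovichTemkinWlodarczyk2024, Thm. 1.1.1 (3) (p. 1562) (functoriality)] -/
theorem admissibleInvariants_bendFormR {p : ℕ} (hp : p ≠ 0) (r e : ℕ) :
    admissibleInvariants (bendFormR k p r e) =
      admissibleInvariants (X 0 ^ p ^ e + (X 1 ^ p + X 1 ^ (p + r)) : MvPolynomial (Fin 2) k) := by
  rw [bendFormR]
  exact admissibleInvariants_map_eq _ (constantCoeff_symm_X_eq_zero_of_forall _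
    (constantCoeff_addPolyShear_X 1 (constantCoeff_bendShiftR (k := k) hp r e))) _

section Ladder

variable (p : ℕ) [hp : Fact p.Prime] [CharP k p]

/-- **The first rung is bent**: for `r = s + 1`, `G_1 = x^p + (y − x)^p + (y − x)^{p+r} = y^p + (y^p − x^p)(y − x)^r
= y^p + (−1)^{r+1} x^{p+r} + (−1)^r r x^{p+r−1} y + R` with `ν_{(p, p+r)}(R) ≥ p(p + r) + 2r` (Frobenius and the
second-order Taylor formula). (derived here) [cite: CossartJannsenSaito2020, Def. 8.2 (1) (p. 118)] [cite: Hauser2010, §C (p. 9)] -/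
theorem isBentR_bendFormR_one (s : ℕ) :
    IsBentR p (s + 1) (bendKR p (s + 1) 1) (p + s) (bendV (s + 1) 1) ((-1) ^ (s + 1) * (s + 1 : ℕ)) (bendFormR k p (s + 1) 1) := by
  classical
  haveI : ExpChar (MvPolynomial (Fin 2) k) p := ExpChar.prime hp.out
  have hp2 : 2 ≤ p := hp.out.two_le
  have h10 : (1 : Fin 2) ≠ 0 := by decide
  obtain ⟨P, hP, hP1, hP2⟩ := exists_sub_pow_taylor₂ (k := k) s
  have hR : bendFormR k p (s + 1) 1 - (X 1 ^ p + C ((bendV (s + 1) 1 : ℤ) : k) * X 0 ^ bendKR p (s + 1) 1 +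
      C ((((-1) ^ (s + 1) * (s + 1 : ℕ) : ℤ)) : k) * (X 0 ^ (p + s) * X 1)) =
      (X 1 ^ p - X 0 ^ p) * P + (-1) ^ (s + 1) * (X 0 ^ (s + 1) * X 1 ^ p) +
        ((s + 1 : ℕ) : MvPolynomial (Fin 2) k) * (-1) ^ s * (X 0 ^ s * X 1 ^ (p + 1)) := by
    rw [bendFormR_eq, bendShiftR_one, bendKR_succ, bendKR_zero, mul_one, pow_one, pow_add (X 1 - X 0) p (s + 1),
      sub_pow_expChar, hP, bendV_one]
    push_cast
    rw [map_pow, map_neg, map_one, map_mul, map_pow, map_neg, map_one, map_add, map_natCast, map_one]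
    ring
  have hK1 : bendKR p (s + 1) 1 = p + (s + 1) := by simp [bendKR]
  unfold IsBentR
  rw [hR, hK1]
  have hPw : ((p * (s + 1) + 2 * (s + 1) : ℕ) : ℕ∞) ≤ monomialOrd (bentWeight p (p + (s + 1))) P := by
    rw [le_monomialOrd_iff]
    intro d hd
    have h1 := (le_monomialOrd_one_iff _ _).1 hP1 d hd
    have h2 := (le_monomialOrd_iff _ _ _).1 hP2 d hd
    rw [degree_fin_two₂₂] at h1
    rw [weight_bentWeight₂₂, mul_zero, mul_one, zero_add] at h2
    rw [weight_bentWeight₂₂]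
    nlinarith
  refine le_monomialOrd_add₂₂ _ (le_monomialOrd_add₂₂ _ ?_ ?_) ?_
  · have h := le_monomialOrd_mul₂₂ (bentWeight p (p + (s + 1)))
      (le_monomialOrd_sub₂₂ (bentWeight p (p + (s + 1))) (A := (X 1 : MvPolynomial (Fin 2) k) ^ p) (B := X 0 ^ p)
        (n := ((p * p : ℕ) : ℕ∞)) ?_ ?_) hPw
    · refine le_trans ?_ h
      exact_mod_cast (by nlinarith)
    · rw [monomialOrd_X_pow₂₂]
      simp only [bentWeight, if_neg h10]
      exact_mod_cast (by nlinarith)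
    · rw [monomialOrd_X_pow₂₂]
      simp only [bentWeight, ↓reduceIte, le_refl]
  · have h := le_monomialOrd_mul₂₂ (bentWeight p (p + (s + 1)))
      (zero_le_monomialOrd₂₂ (bentWeight p (p + (s + 1))) ((-1 : MvPolynomial (Fin 2) k) ^ (s + 1)))
      (le_of_eq (monomialOrd_X_pow_mul_X_pow₂₂ (k := k) (bentWeight p (p + (s + 1))) (s + 1) p).symm)
    refine le_trans ?_ h
    simp only [bentWeight, ↓reduceIte, if_neg h10, zero_add]
    exact_mod_cast (by nlinarith)
  · have h := le_monomialOrd_mul₂₂ (bentWeight p (p + (s + 1)))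
      (le_monomialOrd_mul₂₂ (bentWeight p (p + (s + 1)))
        (zero_le_monomialOrd₂₂ (bentWeight p (p + (s + 1))) (((s + 1 : ℕ) : MvPolynomial (Fin 2) k)))
        (zero_le_monomialOrd₂₂ (bentWeight p (p + (s + 1))) ((-1 : MvPolynomial (Fin 2) k) ^ s)))
      (le_of_eq (monomialOrd_X_pow_mul_X_pow₂₂ (k := k) (bentWeight p (p + (s + 1))) s (p + 1)).symm)
    refine le_trans ?_ h
    simp only [bentWeight, ↓reduceIte, if_neg h10, zero_add]
    exact_mod_cast (by nlinarith)

/-- **Every rung is bent**: for `p ∤ r` and `e ≥ 1` there is `a` with `p a + K_e = p K_e + r` such that `G_e` is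
`(p, r, K_e, a, v_e, (−1)^r r)`-bent (induction via `bendFormR_succ` and the signed bending step). (derived here)
[cite: CossartJannsenSaito2020, Thm. 8.16 (p. 121)] [cite: Hauser2010, §D (p. 12)] -/
theorem isBentR_bendFormR {r : ℕ} (hr : ¬ p ∣ r) {e : ℕ} (he : 1 ≤ e) :
    ∃ a : ℕ, p * a + bendKR p r e = p * bendKR p r e + r ∧
      IsBentR p r (bendKR p r e) a (bendV r e) ((-1) ^ r * r) (bendFormR k p r e) := by
  obtain ⟨s, rfl⟩ : ∃ s, r = s + 1 := ⟨r - 1, by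
    have : r ≠ 0 := fun h => hr (h ▸ dvd_zero p)
    omega⟩
  induction e, he using Nat.le_induction with
  | base =>
    refine ⟨p + s, ?_, ?_⟩
    · simp only [bendKR_succ, bendKR_zero]; ring
    · have h := isBentR_bendFormR_one (k := k) p s
      exact_mod_cast h
  | succ e he ih =>
    obtain ⟨a, hrel, hb⟩ := ih
    refine ⟨p * a, ?_, ?_⟩
    · rw [bendKR_succ]
      have := congrArg (fun t => p * t) hrel
      simp only [mul_add] at this
      nlinarith [this]
    · rw [bendFormR_succ, bendKR_succ, bendV_succ he]
      exact hb.step hrel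

/-- **`max W(G_e) = (p, K_e(r))`** for `p ∤ r`, `e ≥ 1`. (derived here) [cite: CossartJannsenSaito2020, Thm. 8.16 (p. 121)]
[cite: AbramovichTemkinWlodarczyk2024, Thm. 5.1.1 / §5.3 (pp. 1575–1578)] -/
theorem isMaxInv_bendFormR {r : ℕ} (hr : ¬ p ∣ r) {e : ℕ} (he : 1 ≤ e) :
    IsMaxInv (admissibleInvariants (bendFormR k p r e)) [(p : ℚ), ((bendKR p r e : ℕ) : ℚ)] := by
  have hr1 : 1 ≤ r := by
    have : r ≠ 0 := fun h => hr (h ▸ dvd_zero p)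
    omega
  obtain ⟨a, hrel, hb⟩ := isBentR_bendFormR (k := k) p hr he
  exact hb.isMaxInv hp.out.two_le hr1 (lt_bendKR hp.out.one_lt.le hr1 he) hrel (not_dvd_bendKR hr he)
    (cast_bendV_ne_zero (k := k) p hr e)

/-- **The bending ladder for the binomial family: `max W(x^{p^e} + y^p + y^{p+r}) = (p, K_e(r))`,
`K_e(r) = p^e + r (1 + p + ⋯ + p^{e−1}) = p^e + r (p^e − 1)/(p − 1)`, for every prime `p` (the characteristic), every
`r` with `p ∤ r` and every `e ≥ 1`**, over all admissible centres after all polynomial coordinate changes (the split law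
offers only `(p, p^e)`). (derived here) [cite: CossartJannsenSaito2020, Thm. 8.16 (p. 121)]
[cite: Hauser2010, §C (p. 9) and §D (p. 12)] [cite: HauserPerlega2019PRIMS, §7 (p. 798)]
[cite: AbramovichTemkinWlodarczyk2024, Thm. 5.3.1 (2)–(3) (p. 1578)] -/
theorem isMaxInv_bending_family {r : ℕ} (hr : ¬ p ∣ r) {e : ℕ} (he : 1 ≤ e) :
    IsMaxInv (admissibleInvariants (X 0 ^ p ^ e + (X 1 ^ p + X 1 ^ (p + r)) : MvPolynomial (Fin 2) k))
      [(p : ℚ), ((bendKR p r e : ℕ) : ℚ)] := by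
  rw [← admissibleInvariants_bendFormR hp.out.ne_zero]
  exact isMaxInv_bendFormR (k := k) p hr he

/-- The family ladder in closed form: **`max W(x^{p^e} + y^p + y^{p+r}) = (p, p^e + r Σ_{i<e} p^i)`**. (derived here)
[cite: CossartJannsenSaito2020, Thm. 8.16 (p. 121)] [cite: Hauser2010, §D (p. 12)] -/
theorem isMaxInv_bending_family_sum {r : ℕ} (hr : ¬ p ∣ r) {e : ℕ} (he : 1 ≤ e) :
    IsMaxInv (admissibleInvariants (X 0 ^ p ^ e + (X 1 ^ p + X 1 ^ (p + r)) : MvPolynomial (Fin 2) k))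
      [(p : ℚ), ((p ^ e + r * ∑ i ∈ Finset.range e, p ^ i : ℕ) : ℚ)] := by
  rw [← bendKR_eq]
  exact isMaxInv_bending_family (k := k) p hr he

/-- The second rung of the family: **`max W(x^{p²} + y^p + y^{p+r}) = (p, p² + r(p + 1))`**, `p ∤ r`. (derived here)
[cite: Hauser2010, §D (p. 12)] [cite: CossartJannsenSaito2020, Thm. 8.16 (p. 121)] -/
theorem isMaxInv_bending_family_two {r : ℕ} (hr : ¬ p ∣ r) :
    IsMaxInv (admissibleInvariants (X 0 ^ p ^ 2 + (X 1 ^ p + X 1 ^ (p + r)) : MvPolynomial (Fin 2) k))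
      [(p : ℚ), ((p ^ 2 + r * (p + 1) : ℕ) : ℚ)] := by
  have h := isMaxInv_bending_family (k := k) p hr (e := 2) (by norm_num)
  have hK : bendKR p r 2 = p ^ 2 + r * (p + 1) := by simp [bendKR]; ring
  rwa [hK] at h

end Ladder

/-! ## §6 Instances: `(2, 13)`, `(2, 19)`, `(2, 29)`, `(3, 17)` -/

/-- **`max W(x⁴ + y² + y⁵) = (2, 13)` in characteristic `2`** (`r = 3`: `K_2 = 4 + 3·3`). (derived here)
[cite: Hauser2010, §C (p. 9) and §D (p. 12)] [cite: CossartJannsenSaito2020, Thm. 8.16 (p. 121)] -/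
theorem isMaxInv_x4_y2_y5 [CharP k 2] :
    IsMaxInv (admissibleInvariants (X 0 ^ 4 + (X 1 ^ 2 + X 1 ^ 5) : MvPolynomial (Fin 2) k)) [(2 : ℚ), 13] := by
  haveI : Fact (Nat.Prime 2) := ⟨Nat.prime_two⟩
  have h := isMaxInv_bending_family (k := k) 2 (r := 3) (by norm_num) (e := 2) (by norm_num)
  norm_num [bendKR] at h
  exact h

/-- **`max W(x⁴ + y² + y⁷) = (2, 19)` in characteristic `2`** (`r = 5`: `K_2 = 4 + 5·3`). (derived here)
[cite: Hauser2010, §D (p. 12)] [cite: CossartJannsenSaito2020, Thm. 8.16 (p. 121)] -/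
theorem isMaxInv_x4_y2_y7 [CharP k 2] :
    IsMaxInv (admissibleInvariants (X 0 ^ 4 + (X 1 ^ 2 + X 1 ^ 7) : MvPolynomial (Fin 2) k)) [(2 : ℚ), 19] := by
  haveI : Fact (Nat.Prime 2) := ⟨Nat.prime_two⟩
  have h := isMaxInv_bending_family (k := k) 2 (r := 5) (by norm_num) (e := 2) (by norm_num)
  norm_num [bendKR] at h
  exact h

/-- **`max W(x⁸ + y² + y⁵) = (2, 29)` in characteristic `2`** (`r = 3`: `K_3 = 8 + 3·7`). (derived here)
[cite: Hauser2010, §D (p. 12)] [cite: CossartJannsenSaito2020, Thm. 8.16 (p. 121)] -/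
theorem isMaxInv_x8_y2_y5 [CharP k 2] :
    IsMaxInv (admissibleInvariants (X 0 ^ 8 + (X 1 ^ 2 + X 1 ^ 5) : MvPolynomial (Fin 2) k)) [(2 : ℚ), 29] := by
  haveI : Fact (Nat.Prime 2) := ⟨Nat.prime_two⟩
  have h := isMaxInv_bending_family (k := k) 2 (r := 3) (by norm_num) (e := 3) (by norm_num)
  norm_num [bendKR] at h
  exact h

/-- **`max W(x⁹ + y³ + y⁵) = (3, 17)` in characteristic `3`** (`r = 2`: `K_2 = 9 + 2·4`). (derived here)
[cite: Hauser2010, §D (p. 12)] [cite: CossartJannsenSaito2020, Thm. 8.16 (p. 121)] -/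
theorem isMaxInv_x9_y3_y5 [CharP k 3] :
    IsMaxInv (admissibleInvariants (X 0 ^ 9 + (X 1 ^ 3 + X 1 ^ 5) : MvPolynomial (Fin 2) k)) [(3 : ℚ), 17] := by
  haveI : Fact (Nat.Prime 3) := ⟨Nat.prime_three⟩
  have h := isMaxInv_bending_family (k := k) 3 (r := 2) (by norm_num) (e := 2) (by norm_num)
  norm_num [bendKR] at h
  exact h

end WeightedBlowup

end Literature.AlgebraicGeometry.Resolution
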